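import Literature.NumberTheory.LFunctions.ZetaSubOneVerticalSup
import Literature.NumberTheory.LFunctions.ZetaFractionalPartIntegral
import Summits.RiemannHypothesis.RiemannHypothesis.Theorems.JensenLogBandArcDescentR2Flank
import HarnessLib

/-!
# The flank of the own arc right of `1 + δ` ([FL-right], regime R2)

RH ladder column JENSEN, rung J-P(P3) «log band», BAND crux `XiDerivBandRealAllRates`
(stmt-RiemannHypothesis-19913) of route «JensenLogBand», line «band-one-window» (top-shell reshape,
BAND lead rh-jensen-prover g8) — the pointwise flank bound [FL] for own-arc points with abscissa
`Re(½ + u_θ) ≥ 1 + δ`: the sharp R2 descent (F6c) times the elementary bound `‖ζ(s)‖ ≤ 2 + 1/δ`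
right of `1 + δ`. Together with `JensenLogBandArcFlankStrip.lean` (points left of `1 + δ`) this is
the whole pointwise flank input of the saddle-circle assembly. RH-FREE. WHAT THIS IS NOT: nothing
here bears on zeros of `ζ` or the truth of RH.

* `norm_riemannZeta_le_of_one_add_le_re` — `‖ζ(s)‖ ≤ 2 + 1/δ` for `Re s ≥ 1 + δ`, `δ > 0`
  (`‖ζ(s) − 1‖ ≤ ζ(σ) − 1`, Titchmarsh (2.12.2) `ζ(σ) ≤ σ/(σ−1) + 1`);
* **`norm_arcIntegrandU_saddleArc_le_of_le_re`**: in regime R2, for `|θ| < π/2` with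
  `1 + δ ≤ Re(½ + u_θ)`: `‖arcIntegrandU n r c θ‖ ≤ (2 + 1/δ)·e^{12h+6}·‖I_r(φ₀)‖·e^{−(n+1)(1−cos(θ−φ₀))}`.

(prover-rh-jensen-eng-2-g6-0, 2026-08-27.)
-/

noncomputable section

-- single-problem summit: `Summit.RiemannHypothesis.RiemannHypothesis.…` is the tree convention
set_option linter.dupNamespace false

open Complex Real Set

namespace Summit.RiemannHypothesis.RiemannHypothesis.Theorems.JensenPolynomials.LogBandArc

open Literature.NumberTheory.LFunctions

variable {n : ℕ} {x T : ℝ} {u : ℂ}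

/-- **`ζ` right of `1 + δ`:** `‖ζ(s)‖ ≤ 2 + 1/δ` for `Re s ≥ 1 + δ`, `δ > 0`. RH-FREE. [folklore] -/
theorem norm_riemannZeta_le_of_one_add_le_re {s : ℂ} {δ : ℝ} (hδ : 0 < δ) (hs : 1 + δ ≤ s.re) :
    ‖riemannZeta s‖ ≤ 2 + 1 / δ := by
  have hσ1 : 1 < s.re := by linarith
  have h1 := norm_riemannZeta_sub_one_le_re_sub_one hσ1
  -- `ζ(σ) ≤ σ/(σ − 1) + σ/σ = σ/(σ−1) + 1`
  have hσ : (0 : ℝ) < ((s.re : ℂ)).re := by simp; linarith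
  have hσne : ((s.re : ℂ)) ≠ 1 := by
    intro h; have := congrArg Complex.re h; simp at this; linarith
  have h2 := norm_riemannZeta_le_of_re_pos hσ hσne
  have hre : ((s.re : ℂ)).re = s.re := by simp
  have hn1 : ‖((s.re : ℂ))‖ = s.re := by
    rw [Complex.norm_real, Real.norm_eq_abs, abs_of_pos (by linarith)]
  have hn2 : ‖((s.re : ℂ)) - 1‖ = s.re - 1 := by
    rw [show ((s.re : ℂ)) - 1 = (((s.re - 1 : ℝ)) : ℂ) by push_cast; ring, Complex.norm_real,
      Real.norm_eq_abs, abs_of_pos (by linarith)]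
  rw [hre, hn1, hn2, div_self (by linarith : s.re ≠ 0)] at h2
  have h3 : (riemannZeta (s.re : ℂ)).re ≤ ‖riemannZeta (s.re : ℂ)‖ := Complex.re_le_norm _
  have h4 : s.re / (s.re - 1) ≤ 1 + 1 / δ := by
    rw [div_le_iff₀ (by linarith)]
    have : s.re = (s.re - 1) + 1 := by ring
    have hd : 1 ≤ (s.re - 1) * (1 / δ) := by
      rw [mul_one_div, le_div_iff₀ hδ]; linarith
    nlinarith
  calc ‖riemannZeta s‖ = ‖(riemannZeta s - 1) + 1‖ := by ring_nf
    _ ≤ ‖riemannZeta s - 1‖ + ‖(1 : ℂ)‖ := norm_add_le _ _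
    _ ≤ ((riemannZeta (s.re : ℂ)).re - 1) + 1 := by rw [norm_one]; linarith
    _ ≤ 2 + 1 / δ := by linarith

/-- **[FL-right] — the own arc's flank right of `1 + δ` (R2):** regime R2 at the own centre
(`h = h(n,T) ≤ 20`), `u*` the saddle, `r = ‖u* − c‖`, `φ₀ = arg(u* − c)`; for `|θ| < π/2` with
`1 + δ ≤ Re(½ + u_θ)` (`δ > 0`):
`‖arcIntegrandU n r c θ‖ ≤ (2 + 1/δ)·e^{12h+6}·‖I_r(φ₀)‖·exp(−(n+1)(1 − cos(θ − φ₀)))`.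
RH-FREE. [folklore] -/
theorem norm_arcIntegrandU_saddleArc_le_of_le_re {δ : ℝ} (hx : |x| ≤ 1 / 2) (hT : 100 ≤ T)
    (hℓ : 20 ≤ ell T) (hn : 100 ≤ n) (hh : 1 / 2 ≤ bandRadius n T)
    (hhT : bandRadius n T ≤ 7 / 20 * T) (hH : bandRadius n T ≤ 20)
    (hu : ‖u - ((x : ℂ) + (T : ℂ) * I + bandRadius n T)‖ ≤ 3 / 5 * bandRadius n T)
    (hS : arcSaddleFn n ((x : ℂ) + (T : ℂ) * I) u = 0) (hδ : 0 < δ) {θ : ℝ}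
    (hθ : |θ| < Real.pi / 2)
    (hright : 1 + δ ≤ (1 / 2 + circleMap ((x : ℂ) + (T : ℂ) * I) ‖u - ((x : ℂ) + (T : ℂ) * I)‖ θ).re) :
    ‖arcIntegrandU n ‖u - ((x : ℂ) + (T : ℂ) * I)‖ ((x : ℂ) + (T : ℂ) * I) θ‖ ≤
      (2 + 1 / δ) * (Real.exp (12 * bandRadius n T + 6) *
        ‖arcModelIntegrand n ‖u - ((x : ℂ) + (T : ℂ) * I)‖ ((x : ℂ) + (T : ℂ) * I)
          (Complex.arg (u - ((x : ℂ) + (T : ℂ) * I)))‖ *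
        Real.exp (-(((n : ℝ) + 1) *
          (1 - Real.cos (θ - Complex.arg (u - ((x : ℂ) + (T : ℂ) * I))))))) := by
  have hdesc := norm_arcModelIntegrand_le_descent_R2_sub hx hT hℓ hn hh hhT hH hu hS hθ
  set s : ℂ := 1 / 2 + circleMap ((x : ℂ) + (T : ℂ) * I) ‖u - ((x : ℂ) + (T : ℂ) * I)‖ θ with hs
  have hre : 0 < s.re := by linarith
  -- `Im s = T + r sin θ > 0`, so `s ≠ 1`
  obtain ⟨-, hεh, -, hT1200, -⟩ := R2_bookkeeping hT hℓ hh hH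
  obtain ⟨-, -, hr_lo, hr_hi⟩ := arcSaddle_sharp_polar hx hT hℓ hn hh hhT hH hu hS
  have hcoord := half_add_circleMap_eq x T ‖u - ((x : ℂ) + (T : ℂ) * I)‖ θ
  have hsim : s.im = T + ‖u - ((x : ℂ) + (T : ℂ) * I)‖ * Real.sin θ := by
    rw [hs, hcoord]
    simp only [Complex.add_im, Complex.ofReal_im, Complex.mul_im, Complex.I_re, Complex.I_im,
      Complex.ofReal_re]
    ring
  have hsin := (abs_le.1 (Real.abs_sin_le_one θ)).1
  have hr28 : ‖u - ((x : ℂ) + (T : ℂ) * I)‖ ≤ 28 := by linarith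
  have hrs : ‖u - ((x : ℂ) + (T : ℂ) * I)‖ * (-1) ≤ ‖u - ((x : ℂ) + (T : ℂ) * I)‖ * Real.sin θ :=
    mul_le_mul_of_nonneg_left hsin (norm_nonneg _)
  have him : 0 < s.im := by rw [hsim]; linarith
  have hs1 : s ≠ 1 := by
    intro h0; rw [h0] at him; simp at him
  have hζ := norm_riemannZeta_le_of_one_add_le_re hδ hright
  rw [arcIntegrandU_eq_model_mul_zeta n _ _ θ hre hs1, norm_mul]
  have hM0 : 0 ≤ ‖arcModelIntegrand n ‖u - ((x : ℂ) + (T : ℂ) * I)‖ ((x : ℂ) + (T : ℂ) * I) θ‖ :=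
    norm_nonneg _
  calc ‖arcModelIntegrand n ‖u - ((x : ℂ) + (T : ℂ) * I)‖ ((x : ℂ) + (T : ℂ) * I) θ‖ * ‖riemannZeta s‖
      ≤ (Real.exp (12 * bandRadius n T + 6) *
          ‖arcModelIntegrand n ‖u - ((x : ℂ) + (T : ℂ) * I)‖ ((x : ℂ) + (T : ℂ) * I)
            (Complex.arg (u - ((x : ℂ) + (T : ℂ) * I)))‖ *
          Real.exp (-(((n : ℝ) + 1) *
            (1 - Real.cos (θ - Complex.arg (u - ((x : ℂ) + (T : ℂ) * I))))))) * (2 + 1 / δ) :=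
        mul_le_mul hdesc hζ (norm_nonneg _) (by positivity)
    _ = _ := by ring

end Summit.RiemannHypothesis.RiemannHypothesis.Theorems.JensenPolynomials.LogBandArc

end
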